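import Summits.QuantumFields.YangMills.Theorems.BalabanUVNodesN22W1RelCentredTermDatum214WindowDilated
import Summits.QuantumFields.YangMills.Theorems.BalabanUVNodesRateReadingOfRecord13CoPR
import Literature.MathematicalPhysics.QuantumFieldTheory.Balaban1983to89.Node00.HistoryTermIndexedGeneratorTotal

/-!
# v1.6 `CoPR` EDITION (RUN-INDEXED RESIDUAL 𝐓-WEIGHTS, FINDING №8; binder `θ : Stage13RParams F N`, proviso core `θ.Provisos₁₃CoPR F N`) of MODULE J3ᶜᵖʳ (the CoPR-keyed binder storeys of the window-dilated member-currency engine J2) — the `CoP ↦ CoPR` image of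
# this seat's v1.5 module `BalabanUVNodesN22W1RelCentredTermDatum214WindowDilatedKeyedCoP` (p527949).
#
# WHY THIS FILE EXISTS (director-ym №169 H1 ∕ №173 ∕ №174 «v1.6 → rev 22 … pens port their OWN files by token», pub-ymgap INBOX l.19279; node00-def-T FILE 25 `Node00/Record13CoPR`
# (p529474: `structure Stage13RParams extends Stage13Params` with the RUN-INDEXED residual-weight field `Zr`, proviso core `Stage13RParams.Provisos₁₃CoPR`, datum
# `datumOfRecord₁₃CoPR`); node00-def-RR `Node00/Record13DatumKeyCoPR` (`IsDatumOfRecord₁₃CCoPR(On)` with faces `.params ∕ .provisos ∕ .admissible ∕ .datum_eq`); dag-n22-e's v1.6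
# rate-reading homes `…RateCarriersOfRecord13CoPR(On)` ∕ `…N22AtW1Reading13CoPR` ∕ `…RateReadingOfRecord13CoPR` (`readingOfRecord₁₃CoPR`, `rateCarriersOfRecord₁₃CoPR`, the face
# `readingOfRecord₁₃CoPR_bundle_u3 … = u3OfRecord₁₃ θ.toStage13Params ((w1 F θ).u3Objects θ.γ) k := rfl`); dag-lead KEY MAP WORDS-142 l.19649: K3⁶ `SpineGivenEndpointR13SepCoPR` =
# stmt-QuantumFields-20509).  A theorem binding `θ : Stage13Params` cannot be applied at a `Stage13RParams` item tuple's datum (another datum), so this seat's CoP-keyed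
# binder storeys are re-keyed ONCE MORE, token for token (def-T KEY-RULE-25 = dag-lead's WORDS-142 legend): binder `(θ : Stage13Params F N) ↦ (θ : Stage13RParams F N)` ·
# `θ.Provisos₁₃Core ↦ θ.Provisos₁₃CoPR` · `(Is|is)DatumOfRecord₁₃CCoP(On) ↦ …₁₃CCoPR(On)` · stems `…₁₃CoP… ↦ …₁₃CoPR…` (`readingOfRecord₁₃CoPR`, `rateCarriersOfRecord₁₃CoPR`; decl
# names `…tupleReadingOfRecordCoP(On)… ↦ …tupleReadingOfRecordCoPR(On)…`, `…readingOfRecord₁₃CoP(On)… ↦ …readingOfRecord₁₃CoPR(On)…`) and module names `…13CoP ↦ …13CoPR`,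
# `…KeyedCoP ↦ …KeyedCoPR`; SITE RULE (KEY-RULE-25): every θ-level object NOT re-issued is applied AT `θ.toStage13Params` — here the ‴ bundle `u3OfRecord₁₃ θ.toStage13Params …`,
# the generated towers ∕ data `Gn F θ.toStage13Params`, `𝔇 F θ.toStage13Params`, and this seat's θ-level engines (`n22At_u3OfRecord₁₃_…_relCentredTermDatum` of R2,
# `…_windowDilatedTermDatum` of J2), which carry NO proviso and are used BY NAME.  Statements = the CoP statements under the map; proofs = the CoP proofs verbatim (kernel
# re-derivations by name).  PROVISO-FIELD-BLIND and 𝐓-WEIGHT-BLIND (nothing reads a proviso field or `θ.Zr`; they enter as binder TYPES and through RR-2's key — hence a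
# token map).  The Sep ∕ Co ∕ CoP editions stay in the tree as the aside items' context.  Filed `--supports` the K3 item of record AT FILING TIME (K3⁷ `SpineGivenEndpointR13SepCoPH` = stmt-QuantumFields-20544 once dag-lead WORDS-143 serves the v1.7 keys; K3⁶ 20509 before) — HELPER, count-neutral.

Cell `pub-ymgap`, HUMAN RULING D-0062 (Track A), R134 ACCELERATION re-seat `pub-ymgap-dag-n22-c` (strategy s1), generation 7.  THEOREMS ONLY.  Imports J2
`…N22W1RelCentredTermDatum214WindowDilated` (the θ-level member-currency engine, NO proviso, used BY NAME), dag-n22-e's `…RateReadingOfRecord13CoPR`, and W1-6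
`Node00/HistoryTermIndexedGeneratorTotal` (the literally generated towers `Gn₀`).

WHAT.  §1 ★ `n22_tupleReadingOfRecordCoPROn_windowDilatedTermDatum_of_n18Below` (free generator family `Gn` identified with the datum's at the selected run length; guarded by any
regime `Rg`) · `n22_tupleReadingOfRecordCoPR_windowDilatedTermDatum_of_n18Below` (unguarded); §2 ★ `n22_tupleReadingOfRecordCoPROn_windowDilatedTermDatum₀_of_n18Below` ·
`n22_tupleReadingOfRecordCoPR_windowDilatedTermDatum₀_of_n18Below` (the LITERALLY GENERATED reading `Gn := fun F θ k ↦ (𝔇 F θ k).Gn₀`, identification by `Gn₀_eq`).  Tuple: `NeZero θ.τ9.M`,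
`Sg`, `Rz`, `cs`, (`c`, `L`, `NeZero L`, `𝔇` in §1), letters `a a₂ a₂′ a₅ a₅′ Aabs r₁ E₀ Mv cA cP ρb`, members `mF : ℝ → GenTermFun …`, centre `V`; conjuncts = J2's hypotheses (table
inclusion, numerals at `a₅′`, slack, S25, renewal, apertures `0 < cA < cP < 1`, `cP∕(1−cP) < ρ_b`, `0 < Mv`, `(1−cP)⁻²Mv((1+cA)γ)² ≤ ½`, `2(1−cP)⁻²Mv·E₀(1+cA)² ≤ li.A`, `li.r ≤ min(cA,1)`,
base-point freeness, the member `b = 1` = the display, (S-last-T′)ʷ ∕ (S-226-T′)ʷ ∕ (P) ∕ (S-vertex-T′)ʷ below `ksel`).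

HONEST FRAMING.  Count-neutral by-name knit (J2 §2 once per tuple; `readingOfRecord₁₃CoPR_bundle_u3`, `rfl`); NOT a discharge of N22, NOT a closer of `stub_rates13`; ONE conjunct of
`KeyedRates`.  Every member statement is a HYPOTHESIS ((S-vertex-T′) NOT PRINTED — the first missing estimate of row n22 s1, now asked in the producer's own currency); the term-datum
family `𝔇` is DATA; node N18 below is N18's; no inhabitant of `IsDatumOfRecord₁₃CCoPR` ∕ admissible tuple claimed (K0⁵ OPEN); vacuous where `AdmBg … = ∅`; nothing of Bałaban's
asserted; one finite four-torus programme at fixed ε — NOT infinite volume, NOT OS on ℝ⁴, NOT a mass gap, NOT Clay.  0 `sorry`, 0 `def`, standard axioms.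

References (TYPES only): [I] = [Balaban1987RG1] (0.23)–(0.25) pp. 256–257, §1 p. 263, (2.9)–(2.13) pp. 266–268; [II] = [Balaban1988RG2Cluster] (1.41) p. 11, (2.9)–(2.15)
pp. 14–16, (2.26) p. 17, Lemma 3 p. 20, (2.39)–(2.41) p. 21.
-/

noncomputable section

open scoped Matrix.Norms.L2Operator

namespace YMDAG.N22.W1

open Set Metric
open scoped BigOperators
open Literature.MathematicalPhysics.QuantumFieldTheory.Balaban1983to89
open Literature.MathematicalPhysics.QuantumFieldTheory.Balaban1983to89.T4Continuum
open Literature.MathematicalPhysics.QuantumFieldTheory.Balaban1983to89.T4OutputRate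
open Literature.MathematicalPhysics.QuantumFieldTheory.Balaban1983to89.TreeLengthTorus (TPt TDom tsys torusTreeLen torusTreeLen_nonneg)
open Literature.MathematicalPhysics.QuantumFieldTheory.Balaban1983to89.B12TreeDecay (K₀ K₀_pos)
open Literature.MathematicalPhysics.QuantumFieldTheory.Balaban1983to89.B13Lemma3TorusData (TBond)
open Literature.MathematicalPhysics.QuantumFieldTheory.Balaban1983to89.B13Lemma3TorusTerms (terms weight weight_nonneg)
open Literature.MathematicalPhysics.QuantumFieldTheory.Balaban1983to89.B13Lemma3TorusSocket (Lemma3Numerics)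
open Literature.MathematicalPhysics.QuantumFieldTheory.Balaban1983to89.Step (SFConsts)
open Literature.MathematicalPhysics.QuantumFieldTheory.Balaban1983to89.Node00
  (Stage12Params Stage13Params Stage13RParams U3Objects₁₁ U3Letters₁₁ NE2Objects₁₁ NE3Letters₁₁ MatA ιSU prependCoupling)
open Literature.MathematicalPhysics.QuantumFieldTheory.Balaban1983to89.Node00.Sect2 (domSys domCount CPair ofBackgroundC spaceI domSites Setting Residual)
open Literature.MathematicalPhysics.QuantumFieldTheory.Balaban1983to89.Node00.W1
open YMDAG.UVSplit

variable {N : ℕ} [NeZero N]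

/-! ## §1 Free generator family `Gn` identified with the datum's at the selected run length -/

section TupleReading

variable (Gn : (F : T4Family) → (θ : Stage13RParams F N) → (k : ℕ) → GenTower (F.P k) (MatA N) θ.τ9.M)
  (sp : (F : T4Family) → (θ : Stage13RParams F N) → (k j : ℕ) → (domSys (F.P k) θ.τ9.M j).Dom → Set (CPair (F.P k) (MatA N)))
  (gauge : (F : T4Family) → (θ : Stage13RParams F N) → (k : ℕ) → GaugeField (F.P k) 0 (Node00.SU N) → GaugeField (F.P k) 0 (Node00.SU N) → ℝ)
  (hg : ∀ (F : T4Family) (θ : Stage13RParams F N) (k : ℕ) (U U' : GaugeField (F.P k) 0 (Node00.SU N)), 0 ≤ gauge F θ k U U')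
  (T₀ : (F : T4Family) → (θ : Stage13RParams F N) → (k : ℕ) → GaugeField (F.P (k + 1)) 0 (Node00.SU N) → GaugeField (F.P k) 0 (Node00.SU N))
  (hT : ∀ (F : T4Family) (θ : Stage13RParams F N) (k : ℕ) (U : GaugeField (F.P (k + 1)) 0 (Node00.SU N)),
    (∀ (j : ℕ) (Y : (domSys (F.P (k + 1)) θ.τ9.M j).Dom), ofBackgroundC (ιSU N) U ∈ sp F θ (k + 1) j Y) →
      ∀ (j : ℕ) (X : (domSys (F.P k) θ.τ9.M j).Dom), ofBackgroundC (ιSU N) (T₀ F θ k U) ∈ sp F θ k j X)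
  (li : (F : T4Family) → Stage13RParams F N → LetterInputs) (ℓ₃ : T4Family → NE3Letters₁₁)
  (ne2 : (F : T4Family) → Stage13RParams F N → (ℕ → ℝ) → List (ULoop F) → ℕ → NE2Objects₁₁)
  (ne1 : (F : T4Family) → Stage13RParams F N → (ℕ → ℝ) → List (ULoop F) → NE1pCarriers)
  (ksel : (F : T4Family) → Stage13RParams F N → (ℕ → ℝ) → List (ULoop F) → ℕ)
  (Rg : (F : T4Family) → Stage13RParams F N → Prop) {G : Type*} [GaugeGroup G]

open Classical in
/-- **N22's CONJUNCT OF `KeyedRates rr` AT THE LEVEL-SELECTED TUPLE READING OF RECORD (CoP EDITION, binder `Provisos₁₃CoPR`) ON THE GENERATED ADMISSIBLE RUN TOWERS, FROM WINDOW-DILATED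
MEMBER STATEMENTS AT THE (2.14) DATUM, GUARDED BY ANY REGIME `Rg`**: for `rr F θ hP g₀ os := rateCarriersOfRecord₁₃CoPR (readingOfRecord₁₃CoPR (fun F θ ↦ ReadingData.ofRecordAdm F θ.τ9.M N
(runTowers fun k ↦ toClusterTower (Gn F θ k)) …) ℓ₃ ne2 ne1) F θ hP g₀ os (ksel F θ g₀ os)`: node N18 at the run lengths BELOW the selected one at the same reading + the letter signs
(`li.s = ½`, `li.μ = 1`) + per `(F, θ, g₀, os)` in the regime ∃(`NeZero θ.τ9.M`, `Sg`, `Rz`, `cs`, `c`, `L`, `NeZero L`, letters `a a₂ a₂′ a₅ a₅′ Aabs r₁ E₀ Mv cA cP ρb`, a (2.14)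
term-datum family `𝔇` with `Gn F θ (ksel …) = 𝔇.Gn`, a MEMBER family `mF`, a centre `V`): J2's hypotheses (table inclusion; numerals at `a₅′`; slack; S25; renewal `… ≤ E₀`; apertures
`0 < cA < cP < 1`, `cP∕(1−cP) < ρb`; `0 < Mv`, `(1−cP)⁻²Mv·((1+cA)γ)² ≤ ½`, `2(1−cP)⁻²Mv·E₀(1+cA)² ≤ li.A`, `li.r ≤ min(cA,1)`; base-point freeness of `mF` through the real ratio; the
member `b = 1` of base point `s` = the datum's display at `s`; below `ksel`, for every base point `s₀ ∈ ]0,γ]`: holomorphy in `b` + the (2.26) weight bound on `ball 1 ρb`, holomorphy +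
bound in the older terms at every fixed member and for `V` along bounded holomorphic older-term curves, the centred bound `‖mF s₀ … b … − V …‖ ≤ Mv·s₀²·(weight·e^{a₅|Z|})` on `ball 1 ρb`)
⟹ `∀ F θ hP, Rg F θ → θ.Admissible F N → ∀ g₀ os, N22At (rr F θ hP g₀ os).u3`.  ONE conjunct — NOT a closer of `stub_rates13`.
[cite: Balaban1988RG2Cluster, (1.41) p.11, (2.9)-(2.15) pp.14-16, (2.26) p.17, Lemma 3 p.20 and (2.39)-(2.41) p.21; Balaban1987RG1, (0.23)-(0.25) pp.256-257, §1 p.263 and (2.9)-(2.13) pp.266-268] -/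
theorem n22_tupleReadingOfRecordCoPROn_windowDilatedTermDatum_of_n18Below
    (h18 : ∀ (F : T4Family) (θ : Stage13RParams F N) (hP : θ.Provisos₁₃CoPR F N), Rg F θ → θ.Admissible F N → ∀ (g₀ : ℕ → ℝ) (os : List (ULoop F)),
      ∀ k' : ℕ, k' < ksel F θ g₀ os → N18At (u3OfRecord₁₃ θ.toStage13Params ((ReadingData.ofRecordAdm F θ.τ9.M N (runTowers fun k => toClusterTower (Gn F θ k)) (sp F θ)
        (gauge F θ) (hg F θ) (T₀ F θ) (hT F θ) (li F θ)).u3Objects θ.γ) k'))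
    (hnum : ∀ (F : T4Family) (θ : Stage13RParams F N), θ.Provisos₁₃CoPR F N → Rg F θ → θ.Admissible F N →
      0 < (li F θ).C₀ ∧ 0 < (li F θ).θ₅ ∧ (li F θ).θ₅ < 1 ∧ 0 ≤ (li F θ).C₅ ∧ 2 * (li F θ).C₅ / (1 - (li F θ).θ₅) ≤ (li F θ).C₀ ∧ 0 < (li F θ).A ∧
        (li F θ).μ = 1 ∧ 0 < (li F θ).r ∧ (li F θ).s = (2 : ℝ)⁻¹)
    (hdata : ∀ (F : T4Family) (θ : Stage13RParams F N), θ.Provisos₁₃CoPR F N → Rg F θ → θ.Admissible F N → ∀ (g₀ : ℕ → ℝ) (os : List (ULoop F)),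
      ∃ (_ : NeZero θ.τ9.M) (Sg : Setting (MatA N) G) (Rz : Residual (F.P (ksel F θ g₀ os)) (MatA N))
        (cs : SFConsts) (c : B13.Consts) (L : ℕ) (_ : NeZero L) (a a₂ a₂' a₅ a₅' Aabs r₁ E₀ Mv cA cP ρb : ℝ)
        (𝔇 : TermData214 c (F.P (ksel F θ g₀ os)) (MatA N) θ.τ9.M L) (mF : ℝ → GenTermFun (F.P (ksel F θ g₀ os)) (MatA N) θ.τ9.M L)
        (V : (k' : ℕ) → (domSys (F.P (ksel F θ g₀ os)) θ.τ9.M (k' + 1)).Dom → TermLabel (F.P (ksel F θ g₀ os)) θ.τ9.M k' L →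
          OlderTerms (F.P (ksel F θ g₀ os)) (MatA N) θ.τ9.M k' → CPair (F.P (ksel F θ g₀ os)) (MatA N) → ℂ),
        Gn F θ (ksel F θ g₀ os) = 𝔇.Gn ∧
        (∀ (j : ℕ) (Y : (domSys (F.P (ksel F θ g₀ os)) θ.τ9.M j).Dom),
          sp F θ (ksel F θ g₀ os) j Y ⊆ spaceI Sg Rz θ.τ9.M j (domSites (F.P (ksel F θ g₀ os)) θ.τ9.M j Y) cs.α₀ cs.α₁) ∧
        8 ≤ c.L ∧ c.L = L ∧ Lemma3Numerics c θ.τ9.M ((c.L : ℝ) / 2) a a₂ a₂' a₅' Aabs ∧ 0 ≤ c.C3act * c.ε₁ ∧ 0 ≤ r₁ ∧ (li F θ).κ ≤ r₁ ∧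
        r₁ + 2 * (64 * Real.log 162) + 2 ≤ (1 - 8 * c.δ) * ((c.L : ℝ) / 2) * c.κ ∧
        c.C3act * c.ε₁ * Real.exp (5 * r₁ + 1) * K₀ 64 8 * 9 * 64 ≤ 1 ∧
        Real.exp 1 * 9 * 64 * K₀ 64 8 ^ 2 * (c.C3act * c.ε₁) ≤ E₀ ∧
        (∀ (k' : ℕ) (Z : (domSys (F.P (ksel F θ g₀ os)) θ.τ9.M (k' + 1)).Dom), 2 * Real.exp (a₅ * ((Z.1).card : ℝ)) ≤ Real.exp (a₅' * ((Z.1).card : ℝ))) ∧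
        0 < cA ∧ cA < cP ∧ cP < 1 ∧ cP / (1 - cP) < ρb ∧ 0 < Mv ∧ (1 - cP)⁻¹ ^ 2 * Mv * ((1 + cA) * θ.γ) ^ 2 ≤ 1 / 2 ∧
        2 * ((1 - cP)⁻¹ ^ 2 * Mv) * E₀ * (1 + cA) ^ 2 ≤ (li F θ).A ∧ (li F θ).r ≤ min cA 1 ∧
        (∀ (k' : ℕ) (Z : (domSys (F.P (ksel F θ g₀ os)) θ.τ9.M (k' + 1)).Dom) (t : TermLabel (F.P (ksel F θ g₀ os)) θ.τ9.M k' L) (old : OlderTerms (F.P (ksel F θ g₀ os)) (MatA N) θ.τ9.M k')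
          (φ : CPair (F.P (ksel F θ g₀ os)) (MatA N)), ∀ s₀ ∈ Ioc (0 : ℝ) θ.γ, ∀ s₁ ∈ Ioc (0 : ℝ) θ.γ, ∀ b : ℂ, mF s₁ k' Z t ((((s₁ / s₀ : ℝ)) : ℂ) * b) old φ = mF s₀ k' Z t b old φ) ∧
        (∀ (k' : ℕ) (Z : (domSys (F.P (ksel F θ g₀ os)) θ.τ9.M (k' + 1)).Dom) (t : TermLabel (F.P (ksel F θ g₀ os)) θ.τ9.M k' L) (s : ℝ), s ∈ Ioc (0 : ℝ) θ.γ →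
          ∀ (old : OlderTerms (F.P (ksel F θ g₀ os)) (MatA N) θ.τ9.M k') (φ : CPair (F.P (ksel F θ g₀ os)) (MatA N)), mF s k' Z t 1 old φ = (𝔇 k').TF Z t (s : ℂ) old φ) ∧
        (∀ k' : ℕ, k' < ksel F θ g₀ os → ∀ old : OlderTerms (F.P (ksel F θ g₀ os)) (MatA N) θ.τ9.M k',
          (∀ (j : Fin (k' + 1)) (Y : (domSys (F.P (ksel F θ g₀ os)) θ.τ9.M j).Dom) (ψ : CPair (F.P (ksel F θ g₀ os)) (MatA N)),
              ψ ∈ spaceI Sg Rz θ.τ9.M j (domSites (F.P (ksel F θ g₀ os)) θ.τ9.M j Y) cs.α₀ cs.α₁ → ‖old j Y ψ‖ ≤ E₀ * Real.exp (-((li F θ).κ * torusTreeLen Y.1))) →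
          ∀ (X : (domSys (F.P (ksel F θ g₀ os)) θ.τ9.M (k' + 1)).Dom) (φ : CPair (F.P (ksel F θ g₀ os)) (MatA N)), φ ∈ spaceI Sg Rz θ.τ9.M (k' + 1) (domSites (F.P (ksel F θ g₀ os)) θ.τ9.M (k' + 1) X) cs.α₀ cs.α₁ →
            ∀ (Z : (domSys (F.P (ksel F θ g₀ os)) θ.τ9.M (k' + 1)).Dom), Z.1 ⊆ X.1 → ∀ t ∈ terms L θ.τ9.M Z, ∀ s₀ ∈ Ioc (0 : ℝ) θ.γ,
              DifferentiableOn ℂ (fun b => mF s₀ k' Z t b old φ) (ball (1 : ℂ) ρb) ∧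
                ∀ b ∈ ball (1 : ℂ) ρb, ‖mF s₀ k' Z t b old φ‖ ≤ weight L θ.τ9.M c Z a t * Real.exp (a₅ * ((Z.1).card : ℝ))) ∧
        (∀ k' : ℕ, k' < ksel F θ g₀ os → ∀ i : ℕ, i < k' → ∀ (O : Set ℂ), IsOpen O → ∀ s₀ ∈ Ioc (0 : ℝ) θ.γ, ∀ b ∈ ball (1 : ℂ) ρb,
          ∀ cv : ℂ → OlderTerms (F.P (ksel F θ g₀ os)) (MatA N) θ.τ9.M k',
          (∀ (j : Fin (k' + 1)) (Y : (domSys (F.P (ksel F θ g₀ os)) θ.τ9.M j).Dom) (ψ : CPair (F.P (ksel F θ g₀ os)) (MatA N)),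
              ψ ∈ spaceI Sg Rz θ.τ9.M j (domSites (F.P (ksel F θ g₀ os)) θ.τ9.M j Y) cs.α₀ cs.α₁ →
              DifferentiableOn ℂ (fun z => cv z j Y ψ) O ∧ ∀ z ∈ O, ‖cv z j Y ψ‖ ≤ E₀ * Real.exp (-((li F θ).κ * torusTreeLen Y.1))) →
          ∀ (X : (domSys (F.P (ksel F θ g₀ os)) θ.τ9.M (k' + 1)).Dom) (φ : CPair (F.P (ksel F θ g₀ os)) (MatA N)), φ ∈ spaceI Sg Rz θ.τ9.M (k' + 1) (domSites (F.P (ksel F θ g₀ os)) θ.τ9.M (k' + 1) X) cs.α₀ cs.α₁ →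
            ∀ (Z : (domSys (F.P (ksel F θ g₀ os)) θ.τ9.M (k' + 1)).Dom), Z.1 ⊆ X.1 → ∀ t ∈ terms L θ.τ9.M Z,
              DifferentiableOn ℂ (fun z => mF s₀ k' Z t b (cv z) φ) O ∧
                ∀ z ∈ O, ‖mF s₀ k' Z t b (cv z) φ‖ ≤ weight L θ.τ9.M c Z a t * Real.exp (a₅ * ((Z.1).card : ℝ))) ∧
        (∀ k' : ℕ, k' < ksel F θ g₀ os → ∀ (O : Set ℂ), IsOpen O → ∀ cv : ℂ → OlderTerms (F.P (ksel F θ g₀ os)) (MatA N) θ.τ9.M k',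
          (∀ (j : Fin (k' + 1)) (Y : (domSys (F.P (ksel F θ g₀ os)) θ.τ9.M j).Dom) (ψ : CPair (F.P (ksel F θ g₀ os)) (MatA N)),
              ψ ∈ spaceI Sg Rz θ.τ9.M j (domSites (F.P (ksel F θ g₀ os)) θ.τ9.M j Y) cs.α₀ cs.α₁ →
              DifferentiableOn ℂ (fun z => cv z j Y ψ) O ∧ ∀ z ∈ O, ‖cv z j Y ψ‖ ≤ E₀ * Real.exp (-((li F θ).κ * torusTreeLen Y.1))) →
          ∀ (X : (domSys (F.P (ksel F θ g₀ os)) θ.τ9.M (k' + 1)).Dom) (φ : CPair (F.P (ksel F θ g₀ os)) (MatA N)), φ ∈ spaceI Sg Rz θ.τ9.M (k' + 1) (domSites (F.P (ksel F θ g₀ os)) θ.τ9.M (k' + 1) X) cs.α₀ cs.α₁ →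
            ∀ (Z : (domSys (F.P (ksel F θ g₀ os)) θ.τ9.M (k' + 1)).Dom), Z.1 ⊆ X.1 → ∀ t ∈ terms L θ.τ9.M Z,
              DifferentiableOn ℂ (fun z => V k' Z t (cv z) φ) O ∧
                ∀ z ∈ O, ‖V k' Z t (cv z) φ‖ ≤ weight L θ.τ9.M c Z a t * Real.exp (a₅ * ((Z.1).card : ℝ))) ∧
        (∀ k' : ℕ, k' < ksel F θ g₀ os → ∀ old : OlderTerms (F.P (ksel F θ g₀ os)) (MatA N) θ.τ9.M k',
          (∀ (j : Fin (k' + 1)) (Y : (domSys (F.P (ksel F θ g₀ os)) θ.τ9.M j).Dom) (ψ : CPair (F.P (ksel F θ g₀ os)) (MatA N)),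
              ψ ∈ spaceI Sg Rz θ.τ9.M j (domSites (F.P (ksel F θ g₀ os)) θ.τ9.M j Y) cs.α₀ cs.α₁ → ‖old j Y ψ‖ ≤ E₀ * Real.exp (-((li F θ).κ * torusTreeLen Y.1))) →
          ∀ (X : (domSys (F.P (ksel F θ g₀ os)) θ.τ9.M (k' + 1)).Dom) (φ : CPair (F.P (ksel F θ g₀ os)) (MatA N)), φ ∈ spaceI Sg Rz θ.τ9.M (k' + 1) (domSites (F.P (ksel F θ g₀ os)) θ.τ9.M (k' + 1) X) cs.α₀ cs.α₁ →
            ∀ (Z : (domSys (F.P (ksel F θ g₀ os)) θ.τ9.M (k' + 1)).Dom), Z.1 ⊆ X.1 → ∀ t ∈ terms L θ.τ9.M Z, ∀ s₀ ∈ Ioc (0 : ℝ) θ.γ, ∀ b ∈ ball (1 : ℂ) ρb,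
              ‖mF s₀ k' Z t b old φ - V k' Z t old φ‖ ≤ Mv * s₀ ^ 2 * (weight L θ.τ9.M c Z a t * Real.exp (a₅ * ((Z.1).card : ℝ))))) :
    ∀ (F : T4Family) (θ : Stage13RParams F N) (hP : θ.Provisos₁₃CoPR F N), Rg F θ → θ.Admissible F N → ∀ (g₀ : ℕ → ℝ) (os : List (ULoop F)),
      N22At (rateCarriersOfRecord₁₃CoPR (readingOfRecord₁₃CoPR (fun F θ => ReadingData.ofRecordAdm F θ.τ9.M N (runTowers fun k => toClusterTower (Gn F θ k)) (sp F θ)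
        (gauge F θ) (hg F θ) (T₀ F θ) (hT F θ) (li F θ)) ℓ₃ ne2 ne1) F θ hP g₀ os (ksel F θ g₀ os)).u3 := by
  intro F θ hP hRg hθ g₀ os
  obtain ⟨hC₀, hθ5, hθ1, hC5, hC₀', hA, hμ, hr, hs⟩ := hnum F θ hP hRg hθ
  obtain ⟨hMz, Sg, Rz, cs, c, L, hLz, a, a₂, a₂', a₅, a₅', Aabs, r₁, E₀, Mv, cA, cP, ρb, 𝔇, mF, V, hGn, hspk, hL, hLc, hN, hA0, hr₁, hκ, hrate, hsmall, hrenew, h2w,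
    hc0, hcAP, hcP1, hρb, hMv, hMvγ, hAM, hrc, hMbase, hMagree, hMlast, hMprop, hpropV, hMcen⟩ := hdata F θ hP hRg hθ g₀ os
  rw [readingOfRecord₁₃CoPR_bundle_u3]
  exact n22At_u3OfRecord₁₃_ofRecordAdm_runTowers_toClusterTower_of_n18Below_windowDilatedTermDatum θ.toStage13Params (Gn F θ) (sp F θ) (gauge F θ) (hg F θ) (T₀ F θ) (hT F θ) (li F θ)
    (ksel F θ g₀ os) c 𝔇 mF V Sg Rz hGn hspk hL hLc hN hA0 hr₁ hκ hrate hsmall hrenew h2w hc0 hcAP hcP1 hρb hMv hMvγ hAM hMbase hMagree hMlast hMprop hpropV hMcen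
    (h18 F θ hP hRg hθ g₀ os) hC5 hθ1 hC₀' hC₀ hθ5 hA hμ hr hrc hθ.toStage9.gamma_pos hs

open Classical in
/-- **… UNGUARDED** (the skeleton's binder «`∀ F θ hP, θ.Admissible F N → ∀ g₀ os, N22At (rr F θ hP g₀ os).u3`» verbatim: the guarded form at `Rg := fun _ _ ↦ True`).
[cite: Balaban1988RG2Cluster, (2.9)-(2.15) pp.14-16, (2.26) p.17, Lemma 3 p.20 and (2.39)-(2.41) p.21; Balaban1987RG1, (0.23)-(0.25) pp.256-257, §1 p.263 and (2.9)-(2.13) pp.266-268] -/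
theorem n22_tupleReadingOfRecordCoPR_windowDilatedTermDatum_of_n18Below
    (h18 : ∀ (F : T4Family) (θ : Stage13RParams F N) (hP : θ.Provisos₁₃CoPR F N), θ.Admissible F N → ∀ (g₀ : ℕ → ℝ) (os : List (ULoop F)),
      ∀ k' : ℕ, k' < ksel F θ g₀ os → N18At (u3OfRecord₁₃ θ.toStage13Params ((ReadingData.ofRecordAdm F θ.τ9.M N (runTowers fun k => toClusterTower (Gn F θ k)) (sp F θ)
        (gauge F θ) (hg F θ) (T₀ F θ) (hT F θ) (li F θ)).u3Objects θ.γ) k'))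
    (hnum : ∀ (F : T4Family) (θ : Stage13RParams F N), θ.Provisos₁₃CoPR F N → θ.Admissible F N →
      0 < (li F θ).C₀ ∧ 0 < (li F θ).θ₅ ∧ (li F θ).θ₅ < 1 ∧ 0 ≤ (li F θ).C₅ ∧ 2 * (li F θ).C₅ / (1 - (li F θ).θ₅) ≤ (li F θ).C₀ ∧ 0 < (li F θ).A ∧
        (li F θ).μ = 1 ∧ 0 < (li F θ).r ∧ (li F θ).s = (2 : ℝ)⁻¹)
    (hdata : ∀ (F : T4Family) (θ : Stage13RParams F N), θ.Provisos₁₃CoPR F N → θ.Admissible F N → ∀ (g₀ : ℕ → ℝ) (os : List (ULoop F)),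
      ∃ (_ : NeZero θ.τ9.M) (Sg : Setting (MatA N) G) (Rz : Residual (F.P (ksel F θ g₀ os)) (MatA N))
        (cs : SFConsts) (c : B13.Consts) (L : ℕ) (_ : NeZero L) (a a₂ a₂' a₅ a₅' Aabs r₁ E₀ Mv cA cP ρb : ℝ)
        (𝔇 : TermData214 c (F.P (ksel F θ g₀ os)) (MatA N) θ.τ9.M L) (mF : ℝ → GenTermFun (F.P (ksel F θ g₀ os)) (MatA N) θ.τ9.M L)
        (V : (k' : ℕ) → (domSys (F.P (ksel F θ g₀ os)) θ.τ9.M (k' + 1)).Dom → TermLabel (F.P (ksel F θ g₀ os)) θ.τ9.M k' L →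
          OlderTerms (F.P (ksel F θ g₀ os)) (MatA N) θ.τ9.M k' → CPair (F.P (ksel F θ g₀ os)) (MatA N) → ℂ),
        Gn F θ (ksel F θ g₀ os) = 𝔇.Gn ∧
        (∀ (j : ℕ) (Y : (domSys (F.P (ksel F θ g₀ os)) θ.τ9.M j).Dom),
          sp F θ (ksel F θ g₀ os) j Y ⊆ spaceI Sg Rz θ.τ9.M j (domSites (F.P (ksel F θ g₀ os)) θ.τ9.M j Y) cs.α₀ cs.α₁) ∧
        8 ≤ c.L ∧ c.L = L ∧ Lemma3Numerics c θ.τ9.M ((c.L : ℝ) / 2) a a₂ a₂' a₅' Aabs ∧ 0 ≤ c.C3act * c.ε₁ ∧ 0 ≤ r₁ ∧ (li F θ).κ ≤ r₁ ∧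
        r₁ + 2 * (64 * Real.log 162) + 2 ≤ (1 - 8 * c.δ) * ((c.L : ℝ) / 2) * c.κ ∧
        c.C3act * c.ε₁ * Real.exp (5 * r₁ + 1) * K₀ 64 8 * 9 * 64 ≤ 1 ∧
        Real.exp 1 * 9 * 64 * K₀ 64 8 ^ 2 * (c.C3act * c.ε₁) ≤ E₀ ∧
        (∀ (k' : ℕ) (Z : (domSys (F.P (ksel F θ g₀ os)) θ.τ9.M (k' + 1)).Dom), 2 * Real.exp (a₅ * ((Z.1).card : ℝ)) ≤ Real.exp (a₅' * ((Z.1).card : ℝ))) ∧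
        0 < cA ∧ cA < cP ∧ cP < 1 ∧ cP / (1 - cP) < ρb ∧ 0 < Mv ∧ (1 - cP)⁻¹ ^ 2 * Mv * ((1 + cA) * θ.γ) ^ 2 ≤ 1 / 2 ∧
        2 * ((1 - cP)⁻¹ ^ 2 * Mv) * E₀ * (1 + cA) ^ 2 ≤ (li F θ).A ∧ (li F θ).r ≤ min cA 1 ∧
        (∀ (k' : ℕ) (Z : (domSys (F.P (ksel F θ g₀ os)) θ.τ9.M (k' + 1)).Dom) (t : TermLabel (F.P (ksel F θ g₀ os)) θ.τ9.M k' L) (old : OlderTerms (F.P (ksel F θ g₀ os)) (MatA N) θ.τ9.M k')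
          (φ : CPair (F.P (ksel F θ g₀ os)) (MatA N)), ∀ s₀ ∈ Ioc (0 : ℝ) θ.γ, ∀ s₁ ∈ Ioc (0 : ℝ) θ.γ, ∀ b : ℂ, mF s₁ k' Z t ((((s₁ / s₀ : ℝ)) : ℂ) * b) old φ = mF s₀ k' Z t b old φ) ∧
        (∀ (k' : ℕ) (Z : (domSys (F.P (ksel F θ g₀ os)) θ.τ9.M (k' + 1)).Dom) (t : TermLabel (F.P (ksel F θ g₀ os)) θ.τ9.M k' L) (s : ℝ), s ∈ Ioc (0 : ℝ) θ.γ →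
          ∀ (old : OlderTerms (F.P (ksel F θ g₀ os)) (MatA N) θ.τ9.M k') (φ : CPair (F.P (ksel F θ g₀ os)) (MatA N)), mF s k' Z t 1 old φ = (𝔇 k').TF Z t (s : ℂ) old φ) ∧
        (∀ k' : ℕ, k' < ksel F θ g₀ os → ∀ old : OlderTerms (F.P (ksel F θ g₀ os)) (MatA N) θ.τ9.M k',
          (∀ (j : Fin (k' + 1)) (Y : (domSys (F.P (ksel F θ g₀ os)) θ.τ9.M j).Dom) (ψ : CPair (F.P (ksel F θ g₀ os)) (MatA N)),
              ψ ∈ spaceI Sg Rz θ.τ9.M j (domSites (F.P (ksel F θ g₀ os)) θ.τ9.M j Y) cs.α₀ cs.α₁ → ‖old j Y ψ‖ ≤ E₀ * Real.exp (-((li F θ).κ * torusTreeLen Y.1))) →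
          ∀ (X : (domSys (F.P (ksel F θ g₀ os)) θ.τ9.M (k' + 1)).Dom) (φ : CPair (F.P (ksel F θ g₀ os)) (MatA N)), φ ∈ spaceI Sg Rz θ.τ9.M (k' + 1) (domSites (F.P (ksel F θ g₀ os)) θ.τ9.M (k' + 1) X) cs.α₀ cs.α₁ →
            ∀ (Z : (domSys (F.P (ksel F θ g₀ os)) θ.τ9.M (k' + 1)).Dom), Z.1 ⊆ X.1 → ∀ t ∈ terms L θ.τ9.M Z, ∀ s₀ ∈ Ioc (0 : ℝ) θ.γ,
              DifferentiableOn ℂ (fun b => mF s₀ k' Z t b old φ) (ball (1 : ℂ) ρb) ∧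
                ∀ b ∈ ball (1 : ℂ) ρb, ‖mF s₀ k' Z t b old φ‖ ≤ weight L θ.τ9.M c Z a t * Real.exp (a₅ * ((Z.1).card : ℝ))) ∧
        (∀ k' : ℕ, k' < ksel F θ g₀ os → ∀ i : ℕ, i < k' → ∀ (O : Set ℂ), IsOpen O → ∀ s₀ ∈ Ioc (0 : ℝ) θ.γ, ∀ b ∈ ball (1 : ℂ) ρb,
          ∀ cv : ℂ → OlderTerms (F.P (ksel F θ g₀ os)) (MatA N) θ.τ9.M k',
          (∀ (j : Fin (k' + 1)) (Y : (domSys (F.P (ksel F θ g₀ os)) θ.τ9.M j).Dom) (ψ : CPair (F.P (ksel F θ g₀ os)) (MatA N)),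
              ψ ∈ spaceI Sg Rz θ.τ9.M j (domSites (F.P (ksel F θ g₀ os)) θ.τ9.M j Y) cs.α₀ cs.α₁ →
              DifferentiableOn ℂ (fun z => cv z j Y ψ) O ∧ ∀ z ∈ O, ‖cv z j Y ψ‖ ≤ E₀ * Real.exp (-((li F θ).κ * torusTreeLen Y.1))) →
          ∀ (X : (domSys (F.P (ksel F θ g₀ os)) θ.τ9.M (k' + 1)).Dom) (φ : CPair (F.P (ksel F θ g₀ os)) (MatA N)), φ ∈ spaceI Sg Rz θ.τ9.M (k' + 1) (domSites (F.P (ksel F θ g₀ os)) θ.τ9.M (k' + 1) X) cs.α₀ cs.α₁ →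
            ∀ (Z : (domSys (F.P (ksel F θ g₀ os)) θ.τ9.M (k' + 1)).Dom), Z.1 ⊆ X.1 → ∀ t ∈ terms L θ.τ9.M Z,
              DifferentiableOn ℂ (fun z => mF s₀ k' Z t b (cv z) φ) O ∧
                ∀ z ∈ O, ‖mF s₀ k' Z t b (cv z) φ‖ ≤ weight L θ.τ9.M c Z a t * Real.exp (a₅ * ((Z.1).card : ℝ))) ∧
        (∀ k' : ℕ, k' < ksel F θ g₀ os → ∀ (O : Set ℂ), IsOpen O → ∀ cv : ℂ → OlderTerms (F.P (ksel F θ g₀ os)) (MatA N) θ.τ9.M k',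
          (∀ (j : Fin (k' + 1)) (Y : (domSys (F.P (ksel F θ g₀ os)) θ.τ9.M j).Dom) (ψ : CPair (F.P (ksel F θ g₀ os)) (MatA N)),
              ψ ∈ spaceI Sg Rz θ.τ9.M j (domSites (F.P (ksel F θ g₀ os)) θ.τ9.M j Y) cs.α₀ cs.α₁ →
              DifferentiableOn ℂ (fun z => cv z j Y ψ) O ∧ ∀ z ∈ O, ‖cv z j Y ψ‖ ≤ E₀ * Real.exp (-((li F θ).κ * torusTreeLen Y.1))) →
          ∀ (X : (domSys (F.P (ksel F θ g₀ os)) θ.τ9.M (k' + 1)).Dom) (φ : CPair (F.P (ksel F θ g₀ os)) (MatA N)), φ ∈ spaceI Sg Rz θ.τ9.M (k' + 1) (domSites (F.P (ksel F θ g₀ os)) θ.τ9.M (k' + 1) X) cs.α₀ cs.α₁ →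
            ∀ (Z : (domSys (F.P (ksel F θ g₀ os)) θ.τ9.M (k' + 1)).Dom), Z.1 ⊆ X.1 → ∀ t ∈ terms L θ.τ9.M Z,
              DifferentiableOn ℂ (fun z => V k' Z t (cv z) φ) O ∧
                ∀ z ∈ O, ‖V k' Z t (cv z) φ‖ ≤ weight L θ.τ9.M c Z a t * Real.exp (a₅ * ((Z.1).card : ℝ))) ∧
        (∀ k' : ℕ, k' < ksel F θ g₀ os → ∀ old : OlderTerms (F.P (ksel F θ g₀ os)) (MatA N) θ.τ9.M k',
          (∀ (j : Fin (k' + 1)) (Y : (domSys (F.P (ksel F θ g₀ os)) θ.τ9.M j).Dom) (ψ : CPair (F.P (ksel F θ g₀ os)) (MatA N)),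
              ψ ∈ spaceI Sg Rz θ.τ9.M j (domSites (F.P (ksel F θ g₀ os)) θ.τ9.M j Y) cs.α₀ cs.α₁ → ‖old j Y ψ‖ ≤ E₀ * Real.exp (-((li F θ).κ * torusTreeLen Y.1))) →
          ∀ (X : (domSys (F.P (ksel F θ g₀ os)) θ.τ9.M (k' + 1)).Dom) (φ : CPair (F.P (ksel F θ g₀ os)) (MatA N)), φ ∈ spaceI Sg Rz θ.τ9.M (k' + 1) (domSites (F.P (ksel F θ g₀ os)) θ.τ9.M (k' + 1) X) cs.α₀ cs.α₁ →
            ∀ (Z : (domSys (F.P (ksel F θ g₀ os)) θ.τ9.M (k' + 1)).Dom), Z.1 ⊆ X.1 → ∀ t ∈ terms L θ.τ9.M Z, ∀ s₀ ∈ Ioc (0 : ℝ) θ.γ, ∀ b ∈ ball (1 : ℂ) ρb,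
              ‖mF s₀ k' Z t b old φ - V k' Z t old φ‖ ≤ Mv * s₀ ^ 2 * (weight L θ.τ9.M c Z a t * Real.exp (a₅ * ((Z.1).card : ℝ))))) :
    ∀ (F : T4Family) (θ : Stage13RParams F N) (hP : θ.Provisos₁₃CoPR F N), θ.Admissible F N → ∀ (g₀ : ℕ → ℝ) (os : List (ULoop F)),
      N22At (rateCarriersOfRecord₁₃CoPR (readingOfRecord₁₃CoPR (fun F θ => ReadingData.ofRecordAdm F θ.τ9.M N (runTowers fun k => toClusterTower (Gn F θ k)) (sp F θ)
        (gauge F θ) (hg F θ) (T₀ F θ) (hT F θ) (li F θ)) ℓ₃ ne2 ne1) F θ hP g₀ os (ksel F θ g₀ os)).u3 :=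
  fun F θ hP hθ g₀ os =>
    n22_tupleReadingOfRecordCoPROn_windowDilatedTermDatum_of_n18Below Gn sp gauge hg T₀ hT li ℓ₃ ne2 ne1 ksel (fun _ _ => True) (G := G)
      (fun F θ hP _ hθ => h18 F θ hP hθ) (fun F θ hP _ hθ => hnum F θ hP hθ) (fun F θ hP _ hθ => hdata F θ hP hθ) F θ hP trivial hθ g₀ os

end TupleReading

/-! ## §2 The LITERALLY GENERATED reading `Gn := fun F θ k ↦ (𝔇 F θ k).Gn₀` -/

section Generated

variable (c : (F : T4Family) → Stage13RParams F N → ℕ → B13.Consts) (L : (F : T4Family) → Stage13RParams F N → ℕ → ℕ) [hL : ∀ F θ k, NeZero (L F θ k)]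
  (𝔇 : (F : T4Family) → (θ : Stage13RParams F N) → (k : ℕ) → TermData214 (c F θ k) (F.P k) (MatA N) θ.τ9.M (L F θ k))
  (sp : (F : T4Family) → (θ : Stage13RParams F N) → (k j : ℕ) → (domSys (F.P k) θ.τ9.M j).Dom → Set (CPair (F.P k) (MatA N)))
  (gauge : (F : T4Family) → (θ : Stage13RParams F N) → (k : ℕ) → GaugeField (F.P k) 0 (Node00.SU N) → GaugeField (F.P k) 0 (Node00.SU N) → ℝ)
  (hg : ∀ (F : T4Family) (θ : Stage13RParams F N) (k : ℕ) (U U' : GaugeField (F.P k) 0 (Node00.SU N)), 0 ≤ gauge F θ k U U')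
  (T₀ : (F : T4Family) → (θ : Stage13RParams F N) → (k : ℕ) → GaugeField (F.P (k + 1)) 0 (Node00.SU N) → GaugeField (F.P k) 0 (Node00.SU N))
  (hT : ∀ (F : T4Family) (θ : Stage13RParams F N) (k : ℕ) (U : GaugeField (F.P (k + 1)) 0 (Node00.SU N)),
    (∀ (j : ℕ) (Y : (domSys (F.P (k + 1)) θ.τ9.M j).Dom), ofBackgroundC (ιSU N) U ∈ sp F θ (k + 1) j Y) →
      ∀ (j : ℕ) (X : (domSys (F.P k) θ.τ9.M j).Dom), ofBackgroundC (ιSU N) (T₀ F θ k U) ∈ sp F θ k j X)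
  (li : (F : T4Family) → Stage13RParams F N → LetterInputs) (ℓ₃ : T4Family → NE3Letters₁₁)
  (ne2 : (F : T4Family) → Stage13RParams F N → (ℕ → ℝ) → List (ULoop F) → ℕ → NE2Objects₁₁)
  (ne1 : (F : T4Family) → Stage13RParams F N → (ℕ → ℝ) → List (ULoop F) → NE1pCarriers)
  (ksel : (F : T4Family) → Stage13RParams F N → (ℕ → ℝ) → List (ULoop F) → ℕ)
  (Rg : (F : T4Family) → Stage13RParams F N → Prop) {G : Type*} [GaugeGroup G]

open Classical in
/-- **N22's CONJUNCT OF `KeyedRates rr` AT THE LITERALLY GENERATED TUPLE READING OF RECORD (CoP EDITION), FROM WINDOW-DILATED MEMBER STATEMENTS, GUARDED BY ANY REGIME `Rg`** — §1 at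
`Gn := fun F θ k ↦ (𝔇 F θ k).Gn₀` (W1-9's TOTAL generator of the (2.14) term-datum family of record; identification `TermData214.Gn₀_eq` under the tuple's `NeZero θ.τ9.M`): node N18
below `ksel` + signs + per `(F, θ, g₀, os)` in the regime ∃(`NeZero θ.τ9.M`, `Sg`, `Rz`, `cs`, letters `a a₂ a₂′ a₅ a₅′ Aabs r₁ E₀ Mv cA cP ρb`, members `mF`, centre `V`): J2's
hypotheses for the datum `𝔇 F θ (ksel …)`.  ONE conjunct — NOT a closer of `stub_rates13`.
[cite: Balaban1988RG2Cluster, (1.41) p.11, (2.9)-(2.15) pp.14-16, (2.26) p.17, Lemma 3 p.20 and (2.39)-(2.41) p.21; Balaban1987RG1, (0.23)-(0.25) pp.256-257, §1 p.263 and (2.9)-(2.13) pp.266-268] -/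
theorem n22_tupleReadingOfRecordCoPROn_windowDilatedTermDatum₀_of_n18Below
    (h18 : ∀ (F : T4Family) (θ : Stage13RParams F N) (hP : θ.Provisos₁₃CoPR F N), Rg F θ → θ.Admissible F N → ∀ (g₀ : ℕ → ℝ) (os : List (ULoop F)),
      ∀ k' : ℕ, k' < ksel F θ g₀ os → N18At (u3OfRecord₁₃ θ.toStage13Params ((ReadingData.ofRecordAdm F θ.τ9.M N (runTowers fun k => toClusterTower ((𝔇 F θ k).Gn₀)) (sp F θ)
        (gauge F θ) (hg F θ) (T₀ F θ) (hT F θ) (li F θ)).u3Objects θ.γ) k'))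
    (hnum : ∀ (F : T4Family) (θ : Stage13RParams F N), θ.Provisos₁₃CoPR F N → Rg F θ → θ.Admissible F N →
      0 < (li F θ).C₀ ∧ 0 < (li F θ).θ₅ ∧ (li F θ).θ₅ < 1 ∧ 0 ≤ (li F θ).C₅ ∧ 2 * (li F θ).C₅ / (1 - (li F θ).θ₅) ≤ (li F θ).C₀ ∧ 0 < (li F θ).A ∧
        (li F θ).μ = 1 ∧ 0 < (li F θ).r ∧ (li F θ).s = (2 : ℝ)⁻¹)
    (hdata : ∀ (F : T4Family) (θ : Stage13RParams F N), θ.Provisos₁₃CoPR F N → Rg F θ → θ.Admissible F N → ∀ (g₀ : ℕ → ℝ) (os : List (ULoop F)),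
      ∃ (_ : NeZero θ.τ9.M) (Sg : Setting (MatA N) G) (Rz : Residual (F.P (ksel F θ g₀ os)) (MatA N))
        (cs : SFConsts) (a a₂ a₂' a₅ a₅' Aabs r₁ E₀ Mv cA cP ρb : ℝ) (mF : ℝ → GenTermFun (F.P (ksel F θ g₀ os)) (MatA N) θ.τ9.M (L F θ (ksel F θ g₀ os)))
        (V : (k' : ℕ) → (domSys (F.P (ksel F θ g₀ os)) θ.τ9.M (k' + 1)).Dom → TermLabel (F.P (ksel F θ g₀ os)) θ.τ9.M k' (L F θ (ksel F θ g₀ os)) →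
          OlderTerms (F.P (ksel F θ g₀ os)) (MatA N) θ.τ9.M k' → CPair (F.P (ksel F θ g₀ os)) (MatA N) → ℂ),
        (∀ (j : ℕ) (Y : (domSys (F.P (ksel F θ g₀ os)) θ.τ9.M j).Dom),
          sp F θ (ksel F θ g₀ os) j Y ⊆ spaceI Sg Rz θ.τ9.M j (domSites (F.P (ksel F θ g₀ os)) θ.τ9.M j Y) cs.α₀ cs.α₁) ∧
        8 ≤ (c F θ (ksel F θ g₀ os)).L ∧ (c F θ (ksel F θ g₀ os)).L = (L F θ (ksel F θ g₀ os)) ∧ Lemma3Numerics (c F θ (ksel F θ g₀ os)) θ.τ9.M (((c F θ (ksel F θ g₀ os)).L : ℝ) / 2) a a₂ a₂' a₅' Aabs ∧ 0 ≤ (c F θ (ksel F θ g₀ os)).C3act * (c F θ (ksel F θ g₀ os)).ε₁ ∧ 0 ≤ r₁ ∧ (li F θ).κ ≤ r₁ ∧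
        r₁ + 2 * (64 * Real.log 162) + 2 ≤ (1 - 8 * (c F θ (ksel F θ g₀ os)).δ) * (((c F θ (ksel F θ g₀ os)).L : ℝ) / 2) * (c F θ (ksel F θ g₀ os)).κ ∧
        (c F θ (ksel F θ g₀ os)).C3act * (c F θ (ksel F θ g₀ os)).ε₁ * Real.exp (5 * r₁ + 1) * K₀ 64 8 * 9 * 64 ≤ 1 ∧
        Real.exp 1 * 9 * 64 * K₀ 64 8 ^ 2 * ((c F θ (ksel F θ g₀ os)).C3act * (c F θ (ksel F θ g₀ os)).ε₁) ≤ E₀ ∧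
        (∀ (k' : ℕ) (Z : (domSys (F.P (ksel F θ g₀ os)) θ.τ9.M (k' + 1)).Dom), 2 * Real.exp (a₅ * ((Z.1).card : ℝ)) ≤ Real.exp (a₅' * ((Z.1).card : ℝ))) ∧
        0 < cA ∧ cA < cP ∧ cP < 1 ∧ cP / (1 - cP) < ρb ∧ 0 < Mv ∧ (1 - cP)⁻¹ ^ 2 * Mv * ((1 + cA) * θ.γ) ^ 2 ≤ 1 / 2 ∧
        2 * ((1 - cP)⁻¹ ^ 2 * Mv) * E₀ * (1 + cA) ^ 2 ≤ (li F θ).A ∧ (li F θ).r ≤ min cA 1 ∧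
        (∀ (k' : ℕ) (Z : (domSys (F.P (ksel F θ g₀ os)) θ.τ9.M (k' + 1)).Dom) (t : TermLabel (F.P (ksel F θ g₀ os)) θ.τ9.M k' (L F θ (ksel F θ g₀ os))) (old : OlderTerms (F.P (ksel F θ g₀ os)) (MatA N) θ.τ9.M k')
          (φ : CPair (F.P (ksel F θ g₀ os)) (MatA N)), ∀ s₀ ∈ Ioc (0 : ℝ) θ.γ, ∀ s₁ ∈ Ioc (0 : ℝ) θ.γ, ∀ b : ℂ, mF s₁ k' Z t ((((s₁ / s₀ : ℝ)) : ℂ) * b) old φ = mF s₀ k' Z t b old φ) ∧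
        (∀ (k' : ℕ) (Z : (domSys (F.P (ksel F θ g₀ os)) θ.τ9.M (k' + 1)).Dom) (t : TermLabel (F.P (ksel F θ g₀ os)) θ.τ9.M k' (L F θ (ksel F θ g₀ os))) (s : ℝ), s ∈ Ioc (0 : ℝ) θ.γ →
          ∀ (old : OlderTerms (F.P (ksel F θ g₀ os)) (MatA N) θ.τ9.M k') (φ : CPair (F.P (ksel F θ g₀ os)) (MatA N)), mF s k' Z t 1 old φ = (𝔇 F θ (ksel F θ g₀ os) k').TF Z t (s : ℂ) old φ) ∧
        (∀ k' : ℕ, k' < ksel F θ g₀ os → ∀ old : OlderTerms (F.P (ksel F θ g₀ os)) (MatA N) θ.τ9.M k',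
          (∀ (j : Fin (k' + 1)) (Y : (domSys (F.P (ksel F θ g₀ os)) θ.τ9.M j).Dom) (ψ : CPair (F.P (ksel F θ g₀ os)) (MatA N)),
              ψ ∈ spaceI Sg Rz θ.τ9.M j (domSites (F.P (ksel F θ g₀ os)) θ.τ9.M j Y) cs.α₀ cs.α₁ → ‖old j Y ψ‖ ≤ E₀ * Real.exp (-((li F θ).κ * torusTreeLen Y.1))) →
          ∀ (X : (domSys (F.P (ksel F θ g₀ os)) θ.τ9.M (k' + 1)).Dom) (φ : CPair (F.P (ksel F θ g₀ os)) (MatA N)), φ ∈ spaceI Sg Rz θ.τ9.M (k' + 1) (domSites (F.P (ksel F θ g₀ os)) θ.τ9.M (k' + 1) X) cs.α₀ cs.α₁ →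
            ∀ (Z : (domSys (F.P (ksel F θ g₀ os)) θ.τ9.M (k' + 1)).Dom), Z.1 ⊆ X.1 → ∀ t ∈ terms (L F θ (ksel F θ g₀ os)) θ.τ9.M Z, ∀ s₀ ∈ Ioc (0 : ℝ) θ.γ,
              DifferentiableOn ℂ (fun b => mF s₀ k' Z t b old φ) (ball (1 : ℂ) ρb) ∧
                ∀ b ∈ ball (1 : ℂ) ρb, ‖mF s₀ k' Z t b old φ‖ ≤ weight (L F θ (ksel F θ g₀ os)) θ.τ9.M (c F θ (ksel F θ g₀ os)) Z a t * Real.exp (a₅ * ((Z.1).card : ℝ))) ∧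
        (∀ k' : ℕ, k' < ksel F θ g₀ os → ∀ i : ℕ, i < k' → ∀ (O : Set ℂ), IsOpen O → ∀ s₀ ∈ Ioc (0 : ℝ) θ.γ, ∀ b ∈ ball (1 : ℂ) ρb,
          ∀ cv : ℂ → OlderTerms (F.P (ksel F θ g₀ os)) (MatA N) θ.τ9.M k',
          (∀ (j : Fin (k' + 1)) (Y : (domSys (F.P (ksel F θ g₀ os)) θ.τ9.M j).Dom) (ψ : CPair (F.P (ksel F θ g₀ os)) (MatA N)),
              ψ ∈ spaceI Sg Rz θ.τ9.M j (domSites (F.P (ksel F θ g₀ os)) θ.τ9.M j Y) cs.α₀ cs.α₁ →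
              DifferentiableOn ℂ (fun z => cv z j Y ψ) O ∧ ∀ z ∈ O, ‖cv z j Y ψ‖ ≤ E₀ * Real.exp (-((li F θ).κ * torusTreeLen Y.1))) →
          ∀ (X : (domSys (F.P (ksel F θ g₀ os)) θ.τ9.M (k' + 1)).Dom) (φ : CPair (F.P (ksel F θ g₀ os)) (MatA N)), φ ∈ spaceI Sg Rz θ.τ9.M (k' + 1) (domSites (F.P (ksel F θ g₀ os)) θ.τ9.M (k' + 1) X) cs.α₀ cs.α₁ →
            ∀ (Z : (domSys (F.P (ksel F θ g₀ os)) θ.τ9.M (k' + 1)).Dom), Z.1 ⊆ X.1 → ∀ t ∈ terms (L F θ (ksel F θ g₀ os)) θ.τ9.M Z,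
              DifferentiableOn ℂ (fun z => mF s₀ k' Z t b (cv z) φ) O ∧
                ∀ z ∈ O, ‖mF s₀ k' Z t b (cv z) φ‖ ≤ weight (L F θ (ksel F θ g₀ os)) θ.τ9.M (c F θ (ksel F θ g₀ os)) Z a t * Real.exp (a₅ * ((Z.1).card : ℝ))) ∧
        (∀ k' : ℕ, k' < ksel F θ g₀ os → ∀ (O : Set ℂ), IsOpen O → ∀ cv : ℂ → OlderTerms (F.P (ksel F θ g₀ os)) (MatA N) θ.τ9.M k',
          (∀ (j : Fin (k' + 1)) (Y : (domSys (F.P (ksel F θ g₀ os)) θ.τ9.M j).Dom) (ψ : CPair (F.P (ksel F θ g₀ os)) (MatA N)),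
              ψ ∈ spaceI Sg Rz θ.τ9.M j (domSites (F.P (ksel F θ g₀ os)) θ.τ9.M j Y) cs.α₀ cs.α₁ →
              DifferentiableOn ℂ (fun z => cv z j Y ψ) O ∧ ∀ z ∈ O, ‖cv z j Y ψ‖ ≤ E₀ * Real.exp (-((li F θ).κ * torusTreeLen Y.1))) →
          ∀ (X : (domSys (F.P (ksel F θ g₀ os)) θ.τ9.M (k' + 1)).Dom) (φ : CPair (F.P (ksel F θ g₀ os)) (MatA N)), φ ∈ spaceI Sg Rz θ.τ9.M (k' + 1) (domSites (F.P (ksel F θ g₀ os)) θ.τ9.M (k' + 1) X) cs.α₀ cs.α₁ →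
            ∀ (Z : (domSys (F.P (ksel F θ g₀ os)) θ.τ9.M (k' + 1)).Dom), Z.1 ⊆ X.1 → ∀ t ∈ terms (L F θ (ksel F θ g₀ os)) θ.τ9.M Z,
              DifferentiableOn ℂ (fun z => V k' Z t (cv z) φ) O ∧
                ∀ z ∈ O, ‖V k' Z t (cv z) φ‖ ≤ weight (L F θ (ksel F θ g₀ os)) θ.τ9.M (c F θ (ksel F θ g₀ os)) Z a t * Real.exp (a₅ * ((Z.1).card : ℝ))) ∧
        (∀ k' : ℕ, k' < ksel F θ g₀ os → ∀ old : OlderTerms (F.P (ksel F θ g₀ os)) (MatA N) θ.τ9.M k',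
          (∀ (j : Fin (k' + 1)) (Y : (domSys (F.P (ksel F θ g₀ os)) θ.τ9.M j).Dom) (ψ : CPair (F.P (ksel F θ g₀ os)) (MatA N)),
              ψ ∈ spaceI Sg Rz θ.τ9.M j (domSites (F.P (ksel F θ g₀ os)) θ.τ9.M j Y) cs.α₀ cs.α₁ → ‖old j Y ψ‖ ≤ E₀ * Real.exp (-((li F θ).κ * torusTreeLen Y.1))) →
          ∀ (X : (domSys (F.P (ksel F θ g₀ os)) θ.τ9.M (k' + 1)).Dom) (φ : CPair (F.P (ksel F θ g₀ os)) (MatA N)), φ ∈ spaceI Sg Rz θ.τ9.M (k' + 1) (domSites (F.P (ksel F θ g₀ os)) θ.τ9.M (k' + 1) X) cs.α₀ cs.α₁ →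
            ∀ (Z : (domSys (F.P (ksel F θ g₀ os)) θ.τ9.M (k' + 1)).Dom), Z.1 ⊆ X.1 → ∀ t ∈ terms (L F θ (ksel F θ g₀ os)) θ.τ9.M Z, ∀ s₀ ∈ Ioc (0 : ℝ) θ.γ, ∀ b ∈ ball (1 : ℂ) ρb,
              ‖mF s₀ k' Z t b old φ - V k' Z t old φ‖ ≤ Mv * s₀ ^ 2 * (weight (L F θ (ksel F θ g₀ os)) θ.τ9.M (c F θ (ksel F θ g₀ os)) Z a t * Real.exp (a₅ * ((Z.1).card : ℝ))))) :
    ∀ (F : T4Family) (θ : Stage13RParams F N) (hP : θ.Provisos₁₃CoPR F N), Rg F θ → θ.Admissible F N → ∀ (g₀ : ℕ → ℝ) (os : List (ULoop F)),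
      N22At (rateCarriersOfRecord₁₃CoPR (readingOfRecord₁₃CoPR (fun F θ => ReadingData.ofRecordAdm F θ.τ9.M N (runTowers fun k => toClusterTower ((𝔇 F θ k).Gn₀)) (sp F θ)
        (gauge F θ) (hg F θ) (T₀ F θ) (hT F θ) (li F θ)) ℓ₃ ne2 ne1) F θ hP g₀ os (ksel F θ g₀ os)).u3 := by
  refine n22_tupleReadingOfRecordCoPROn_windowDilatedTermDatum_of_n18Below (fun F θ k => (𝔇 F θ k).Gn₀) sp gauge hg T₀ hT li ℓ₃ ne2 ne1 ksel Rg (G := G) h18 hnum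
    fun F θ hP hRg hθ g₀ os => ?_
  obtain ⟨hMz, Sg, Rz, cs, a, a₂, a₂', a₅, a₅', Aabs, r₁, E₀, Mv, cA, cP, ρb, mF, V, hspk, hrest⟩ := hdata F θ hP hRg hθ g₀ os
  exact ⟨hMz, Sg, Rz, cs, c F θ (ksel F θ g₀ os), L F θ (ksel F θ g₀ os), hL F θ (ksel F θ g₀ os), a, a₂, a₂', a₅, a₅', Aabs, r₁, E₀, Mv, cA, cP, ρb, 𝔇 F θ (ksel F θ g₀ os), mF, V,
    TermData214.Gn₀_eq (𝔇 F θ (ksel F θ g₀ os)), hspk, hrest⟩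

open Classical in
/-- **… UNGUARDED** (the skeleton's binder verbatim; the guarded form at `Rg := fun _ _ ↦ True`).
[cite: Balaban1988RG2Cluster, (2.9)-(2.15) pp.14-16, (2.26) p.17, Lemma 3 p.20 and (2.39)-(2.41) p.21; Balaban1987RG1, (0.23)-(0.25) pp.256-257, §1 p.263 and (2.9)-(2.13) pp.266-268] -/
theorem n22_tupleReadingOfRecordCoPR_windowDilatedTermDatum₀_of_n18Below
    (h18 : ∀ (F : T4Family) (θ : Stage13RParams F N) (hP : θ.Provisos₁₃CoPR F N), θ.Admissible F N → ∀ (g₀ : ℕ → ℝ) (os : List (ULoop F)),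
      ∀ k' : ℕ, k' < ksel F θ g₀ os → N18At (u3OfRecord₁₃ θ.toStage13Params ((ReadingData.ofRecordAdm F θ.τ9.M N (runTowers fun k => toClusterTower ((𝔇 F θ k).Gn₀)) (sp F θ)
        (gauge F θ) (hg F θ) (T₀ F θ) (hT F θ) (li F θ)).u3Objects θ.γ) k'))
    (hnum : ∀ (F : T4Family) (θ : Stage13RParams F N), θ.Provisos₁₃CoPR F N → θ.Admissible F N →
      0 < (li F θ).C₀ ∧ 0 < (li F θ).θ₅ ∧ (li F θ).θ₅ < 1 ∧ 0 ≤ (li F θ).C₅ ∧ 2 * (li F θ).C₅ / (1 - (li F θ).θ₅) ≤ (li F θ).C₀ ∧ 0 < (li F θ).A ∧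
        (li F θ).μ = 1 ∧ 0 < (li F θ).r ∧ (li F θ).s = (2 : ℝ)⁻¹)
    (hdata : ∀ (F : T4Family) (θ : Stage13RParams F N), θ.Provisos₁₃CoPR F N → θ.Admissible F N → ∀ (g₀ : ℕ → ℝ) (os : List (ULoop F)),
      ∃ (_ : NeZero θ.τ9.M) (Sg : Setting (MatA N) G) (Rz : Residual (F.P (ksel F θ g₀ os)) (MatA N))
        (cs : SFConsts) (a a₂ a₂' a₅ a₅' Aabs r₁ E₀ Mv cA cP ρb : ℝ) (mF : ℝ → GenTermFun (F.P (ksel F θ g₀ os)) (MatA N) θ.τ9.M (L F θ (ksel F θ g₀ os)))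
        (V : (k' : ℕ) → (domSys (F.P (ksel F θ g₀ os)) θ.τ9.M (k' + 1)).Dom → TermLabel (F.P (ksel F θ g₀ os)) θ.τ9.M k' (L F θ (ksel F θ g₀ os)) →
          OlderTerms (F.P (ksel F θ g₀ os)) (MatA N) θ.τ9.M k' → CPair (F.P (ksel F θ g₀ os)) (MatA N) → ℂ),
        (∀ (j : ℕ) (Y : (domSys (F.P (ksel F θ g₀ os)) θ.τ9.M j).Dom),
          sp F θ (ksel F θ g₀ os) j Y ⊆ spaceI Sg Rz θ.τ9.M j (domSites (F.P (ksel F θ g₀ os)) θ.τ9.M j Y) cs.α₀ cs.α₁) ∧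
        8 ≤ (c F θ (ksel F θ g₀ os)).L ∧ (c F θ (ksel F θ g₀ os)).L = (L F θ (ksel F θ g₀ os)) ∧ Lemma3Numerics (c F θ (ksel F θ g₀ os)) θ.τ9.M (((c F θ (ksel F θ g₀ os)).L : ℝ) / 2) a a₂ a₂' a₅' Aabs ∧ 0 ≤ (c F θ (ksel F θ g₀ os)).C3act * (c F θ (ksel F θ g₀ os)).ε₁ ∧ 0 ≤ r₁ ∧ (li F θ).κ ≤ r₁ ∧
        r₁ + 2 * (64 * Real.log 162) + 2 ≤ (1 - 8 * (c F θ (ksel F θ g₀ os)).δ) * (((c F θ (ksel F θ g₀ os)).L : ℝ) / 2) * (c F θ (ksel F θ g₀ os)).κ ∧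
        (c F θ (ksel F θ g₀ os)).C3act * (c F θ (ksel F θ g₀ os)).ε₁ * Real.exp (5 * r₁ + 1) * K₀ 64 8 * 9 * 64 ≤ 1 ∧
        Real.exp 1 * 9 * 64 * K₀ 64 8 ^ 2 * ((c F θ (ksel F θ g₀ os)).C3act * (c F θ (ksel F θ g₀ os)).ε₁) ≤ E₀ ∧
        (∀ (k' : ℕ) (Z : (domSys (F.P (ksel F θ g₀ os)) θ.τ9.M (k' + 1)).Dom), 2 * Real.exp (a₅ * ((Z.1).card : ℝ)) ≤ Real.exp (a₅' * ((Z.1).card : ℝ))) ∧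
        0 < cA ∧ cA < cP ∧ cP < 1 ∧ cP / (1 - cP) < ρb ∧ 0 < Mv ∧ (1 - cP)⁻¹ ^ 2 * Mv * ((1 + cA) * θ.γ) ^ 2 ≤ 1 / 2 ∧
        2 * ((1 - cP)⁻¹ ^ 2 * Mv) * E₀ * (1 + cA) ^ 2 ≤ (li F θ).A ∧ (li F θ).r ≤ min cA 1 ∧
        (∀ (k' : ℕ) (Z : (domSys (F.P (ksel F θ g₀ os)) θ.τ9.M (k' + 1)).Dom) (t : TermLabel (F.P (ksel F θ g₀ os)) θ.τ9.M k' (L F θ (ksel F θ g₀ os))) (old : OlderTerms (F.P (ksel F θ g₀ os)) (MatA N) θ.τ9.M k')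
          (φ : CPair (F.P (ksel F θ g₀ os)) (MatA N)), ∀ s₀ ∈ Ioc (0 : ℝ) θ.γ, ∀ s₁ ∈ Ioc (0 : ℝ) θ.γ, ∀ b : ℂ, mF s₁ k' Z t ((((s₁ / s₀ : ℝ)) : ℂ) * b) old φ = mF s₀ k' Z t b old φ) ∧
        (∀ (k' : ℕ) (Z : (domSys (F.P (ksel F θ g₀ os)) θ.τ9.M (k' + 1)).Dom) (t : TermLabel (F.P (ksel F θ g₀ os)) θ.τ9.M k' (L F θ (ksel F θ g₀ os))) (s : ℝ), s ∈ Ioc (0 : ℝ) θ.γ →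
          ∀ (old : OlderTerms (F.P (ksel F θ g₀ os)) (MatA N) θ.τ9.M k') (φ : CPair (F.P (ksel F θ g₀ os)) (MatA N)), mF s k' Z t 1 old φ = (𝔇 F θ (ksel F θ g₀ os) k').TF Z t (s : ℂ) old φ) ∧
        (∀ k' : ℕ, k' < ksel F θ g₀ os → ∀ old : OlderTerms (F.P (ksel F θ g₀ os)) (MatA N) θ.τ9.M k',
          (∀ (j : Fin (k' + 1)) (Y : (domSys (F.P (ksel F θ g₀ os)) θ.τ9.M j).Dom) (ψ : CPair (F.P (ksel F θ g₀ os)) (MatA N)),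
              ψ ∈ spaceI Sg Rz θ.τ9.M j (domSites (F.P (ksel F θ g₀ os)) θ.τ9.M j Y) cs.α₀ cs.α₁ → ‖old j Y ψ‖ ≤ E₀ * Real.exp (-((li F θ).κ * torusTreeLen Y.1))) →
          ∀ (X : (domSys (F.P (ksel F θ g₀ os)) θ.τ9.M (k' + 1)).Dom) (φ : CPair (F.P (ksel F θ g₀ os)) (MatA N)), φ ∈ spaceI Sg Rz θ.τ9.M (k' + 1) (domSites (F.P (ksel F θ g₀ os)) θ.τ9.M (k' + 1) X) cs.α₀ cs.α₁ →
            ∀ (Z : (domSys (F.P (ksel F θ g₀ os)) θ.τ9.M (k' + 1)).Dom), Z.1 ⊆ X.1 → ∀ t ∈ terms (L F θ (ksel F θ g₀ os)) θ.τ9.M Z, ∀ s₀ ∈ Ioc (0 : ℝ) θ.γ,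
              DifferentiableOn ℂ (fun b => mF s₀ k' Z t b old φ) (ball (1 : ℂ) ρb) ∧
                ∀ b ∈ ball (1 : ℂ) ρb, ‖mF s₀ k' Z t b old φ‖ ≤ weight (L F θ (ksel F θ g₀ os)) θ.τ9.M (c F θ (ksel F θ g₀ os)) Z a t * Real.exp (a₅ * ((Z.1).card : ℝ))) ∧
        (∀ k' : ℕ, k' < ksel F θ g₀ os → ∀ i : ℕ, i < k' → ∀ (O : Set ℂ), IsOpen O → ∀ s₀ ∈ Ioc (0 : ℝ) θ.γ, ∀ b ∈ ball (1 : ℂ) ρb,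
          ∀ cv : ℂ → OlderTerms (F.P (ksel F θ g₀ os)) (MatA N) θ.τ9.M k',
          (∀ (j : Fin (k' + 1)) (Y : (domSys (F.P (ksel F θ g₀ os)) θ.τ9.M j).Dom) (ψ : CPair (F.P (ksel F θ g₀ os)) (MatA N)),
              ψ ∈ spaceI Sg Rz θ.τ9.M j (domSites (F.P (ksel F θ g₀ os)) θ.τ9.M j Y) cs.α₀ cs.α₁ →
              DifferentiableOn ℂ (fun z => cv z j Y ψ) O ∧ ∀ z ∈ O, ‖cv z j Y ψ‖ ≤ E₀ * Real.exp (-((li F θ).κ * torusTreeLen Y.1))) →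
          ∀ (X : (domSys (F.P (ksel F θ g₀ os)) θ.τ9.M (k' + 1)).Dom) (φ : CPair (F.P (ksel F θ g₀ os)) (MatA N)), φ ∈ spaceI Sg Rz θ.τ9.M (k' + 1) (domSites (F.P (ksel F θ g₀ os)) θ.τ9.M (k' + 1) X) cs.α₀ cs.α₁ →
            ∀ (Z : (domSys (F.P (ksel F θ g₀ os)) θ.τ9.M (k' + 1)).Dom), Z.1 ⊆ X.1 → ∀ t ∈ terms (L F θ (ksel F θ g₀ os)) θ.τ9.M Z,
              DifferentiableOn ℂ (fun z => mF s₀ k' Z t b (cv z) φ) O ∧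
                ∀ z ∈ O, ‖mF s₀ k' Z t b (cv z) φ‖ ≤ weight (L F θ (ksel F θ g₀ os)) θ.τ9.M (c F θ (ksel F θ g₀ os)) Z a t * Real.exp (a₅ * ((Z.1).card : ℝ))) ∧
        (∀ k' : ℕ, k' < ksel F θ g₀ os → ∀ (O : Set ℂ), IsOpen O → ∀ cv : ℂ → OlderTerms (F.P (ksel F θ g₀ os)) (MatA N) θ.τ9.M k',
          (∀ (j : Fin (k' + 1)) (Y : (domSys (F.P (ksel F θ g₀ os)) θ.τ9.M j).Dom) (ψ : CPair (F.P (ksel F θ g₀ os)) (MatA N)),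
              ψ ∈ spaceI Sg Rz θ.τ9.M j (domSites (F.P (ksel F θ g₀ os)) θ.τ9.M j Y) cs.α₀ cs.α₁ →
              DifferentiableOn ℂ (fun z => cv z j Y ψ) O ∧ ∀ z ∈ O, ‖cv z j Y ψ‖ ≤ E₀ * Real.exp (-((li F θ).κ * torusTreeLen Y.1))) →
          ∀ (X : (domSys (F.P (ksel F θ g₀ os)) θ.τ9.M (k' + 1)).Dom) (φ : CPair (F.P (ksel F θ g₀ os)) (MatA N)), φ ∈ spaceI Sg Rz θ.τ9.M (k' + 1) (domSites (F.P (ksel F θ g₀ os)) θ.τ9.M (k' + 1) X) cs.α₀ cs.α₁ →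
            ∀ (Z : (domSys (F.P (ksel F θ g₀ os)) θ.τ9.M (k' + 1)).Dom), Z.1 ⊆ X.1 → ∀ t ∈ terms (L F θ (ksel F θ g₀ os)) θ.τ9.M Z,
              DifferentiableOn ℂ (fun z => V k' Z t (cv z) φ) O ∧
                ∀ z ∈ O, ‖V k' Z t (cv z) φ‖ ≤ weight (L F θ (ksel F θ g₀ os)) θ.τ9.M (c F θ (ksel F θ g₀ os)) Z a t * Real.exp (a₅ * ((Z.1).card : ℝ))) ∧
        (∀ k' : ℕ, k' < ksel F θ g₀ os → ∀ old : OlderTerms (F.P (ksel F θ g₀ os)) (MatA N) θ.τ9.M k',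
          (∀ (j : Fin (k' + 1)) (Y : (domSys (F.P (ksel F θ g₀ os)) θ.τ9.M j).Dom) (ψ : CPair (F.P (ksel F θ g₀ os)) (MatA N)),
              ψ ∈ spaceI Sg Rz θ.τ9.M j (domSites (F.P (ksel F θ g₀ os)) θ.τ9.M j Y) cs.α₀ cs.α₁ → ‖old j Y ψ‖ ≤ E₀ * Real.exp (-((li F θ).κ * torusTreeLen Y.1))) →
          ∀ (X : (domSys (F.P (ksel F θ g₀ os)) θ.τ9.M (k' + 1)).Dom) (φ : CPair (F.P (ksel F θ g₀ os)) (MatA N)), φ ∈ spaceI Sg Rz θ.τ9.M (k' + 1) (domSites (F.P (ksel F θ g₀ os)) θ.τ9.M (k' + 1) X) cs.α₀ cs.α₁ →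
            ∀ (Z : (domSys (F.P (ksel F θ g₀ os)) θ.τ9.M (k' + 1)).Dom), Z.1 ⊆ X.1 → ∀ t ∈ terms (L F θ (ksel F θ g₀ os)) θ.τ9.M Z, ∀ s₀ ∈ Ioc (0 : ℝ) θ.γ, ∀ b ∈ ball (1 : ℂ) ρb,
              ‖mF s₀ k' Z t b old φ - V k' Z t old φ‖ ≤ Mv * s₀ ^ 2 * (weight (L F θ (ksel F θ g₀ os)) θ.τ9.M (c F θ (ksel F θ g₀ os)) Z a t * Real.exp (a₅ * ((Z.1).card : ℝ))))) :
    ∀ (F : T4Family) (θ : Stage13RParams F N) (hP : θ.Provisos₁₃CoPR F N), θ.Admissible F N → ∀ (g₀ : ℕ → ℝ) (os : List (ULoop F)),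
      N22At (rateCarriersOfRecord₁₃CoPR (readingOfRecord₁₃CoPR (fun F θ => ReadingData.ofRecordAdm F θ.τ9.M N (runTowers fun k => toClusterTower ((𝔇 F θ k).Gn₀)) (sp F θ)
        (gauge F θ) (hg F θ) (T₀ F θ) (hT F θ) (li F θ)) ℓ₃ ne2 ne1) F θ hP g₀ os (ksel F θ g₀ os)).u3 :=
  fun F θ hP hθ g₀ os =>
    n22_tupleReadingOfRecordCoPROn_windowDilatedTermDatum₀_of_n18Below c L 𝔇 sp gauge hg T₀ hT li ℓ₃ ne2 ne1 ksel (fun _ _ => True) (G := G)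
      (fun F θ hP _ hθ => h18 F θ hP hθ) (fun F θ hP _ hθ => hnum F θ hP hθ) (fun F θ hP _ hθ => hdata F θ hP hθ) F θ hP trivial hθ g₀ os

end Generated

end YMDAG.N22.W1

end
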